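import Mathlib.Analysis.SpecificLimits.Basic
import Mathlib.Algebra.Order.Field.GeomSum
import Mathlib.Algebra.BigOperators.Field
import Mathlib.Data.Nat.Log
import Mathlib.Algebra.BigOperators.Fin
import HarnessLib

/-!
# An explicit unpredictable lattice walk: dyadic random velocities

Benjamini–Pemantle–Peres (*Unpredictable paths and percolation*, Ann. Probab. **26** (1998),
arXiv:math/9701227, Theorem 1.1) construct nearest-neighbour processes on `ℤ` whose
*predictability profile* `sup P[S_{n+k} = x | S_0 … S_n]` decays like `k^{-α}`, `α > 1/2` — the
ingredient of the exponential-intersection-tails path measures on `ℤ³` used by Garban–Spencer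
(arXiv:2109.01617, Theorem 2.4).  Their construction sums Ising spins on a tree.  For the tree's
proof of `GarbanSpencer2022_xyLongRangeOrder` we use instead the following elementary *lazy*
walk (steps in `{0, 1}`, which is all the lattice-path construction needs), whose unpredictability
is transparent:

* randomness: for every dyadic scale `i ≤ K` and block index `b ≤ m` an independent uniform
  grid value `η (i, b) ∈ {0, 1/N, …, 1}`, `N = 2^K`;
* velocity at time `t`: `v(t) = ∑_{i ≤ K} c_i η(i, ⌊t/2^i⌋)` with `c_i = (3/4)^i / 8`
  (so `0 ≤ v ≤ 1/2`); position `W(t) = ∑_{t' < t} v(t')`, lattice position `S(t) = ⌊W(t)⌋`.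

Then (all proved here): `S(0) = 0`, `S(t+1) − S(t) ∈ {0,1}`, `0 ≤ S(t) ≤ t/2`
(`ipos_succ_sub_mem`, `ipos_le`); **locality**: `S(t)` only depends on the variables of blocks
starting before `t` (`pos_congr`); and **unpredictability**: inside any window `[s, s+r)` with
`r ≥ 4` there is a complete block of scale `i⋆ = ⌊log₂ r⌋ − 1` starting at or after `s`, whose
variable enters `W(s+r)` linearly with coefficient `κ = c_{i⋆} 2^{i⋆} ≥ (3/2)^{i⋆}/8`
(`pos_update_fresh`), so that, whatever all other variables are, at most `9N/κ + 1` of the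
`N + 1` values of that variable put `S(s+r)` in a given window of width `9` (`card_fiber_le`) —
a predictability profile `≍ r^{-log₂(3/2)} = r^{-0.58…}`, square-summable as BPP require for `ℤ³`.

## References

* I. Benjamini, R. Pemantle, Y. Peres, Ann. Probab. 26 (1998) 1198–1211 = arXiv:math/9701227,
  Theorem 1.1 and §3 (the role of the predictability profile). [BenjaminiPemantlePeres1998]
* C. Garban, T. Spencer, arXiv:2109.01617, Theorem 2.4. [GarbanSpencer2022]
-/

noncomputable section

open Finset
open scoped BigOperators

namespace Literature.Probability.LatticeModels

namespace DyadicWalk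

/-! ### Coordinates of the randomness -/

/-- The index set of the random variables of one walk with `K + 1` dyadic scales and horizon
`m`: a scale `i ≤ K` and a block index `b ≤ m`. [folklore] -/
abbrev Coord (K m : ℕ) : Type := Fin (K + 1) × Fin (m + 1)

/-- The starting time `b · 2^i` of the block `(i, b)`. [folklore] -/
def start {K m : ℕ} (c : Coord K m) : ℕ := (c.2 : ℕ) * 2 ^ (c.1 : ℕ)

/-- The grid size `N = 2^K` (grid values `j/N`, `j = 0, …, N`). [folklore] -/
def gridN (K : ℕ) : ℕ := 2 ^ K

/-- The block of scale `i` containing time `t` (truncated at the horizon, which is harmless for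
`t ≤ m`). [folklore] -/
def blk {K : ℕ} (m : ℕ) (i : Fin (K + 1)) (t : ℕ) : Fin (m + 1) :=
  ⟨min (t / 2 ^ (i : ℕ)) m, Nat.lt_succ_of_le (min_le_right _ _)⟩

/-- The velocity weights `c_i = (3/4)^i / 8`. [folklore] -/
def cWt (i : ℕ) : ℝ := (3 / 4 : ℝ) ^ i / 8

/-- `c_i > 0`. [folklore] -/
theorem cWt_pos (i : ℕ) : 0 < cWt i := by unfold cWt; positivity

/-- `∑_{i ≤ K} c_i ≤ 1/2` (geometric series). [folklore] -/
theorem sum_cWt_le (K : ℕ) : ∑ i : Fin (K + 1), cWt i ≤ 1 / 2 := by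
  have h : ∑ i ∈ Finset.range (K + 1), (3 / 4 : ℝ) ^ i ≤ 4 := by
    have := geom_sum_Ico_le_of_lt_one (m := 0) (n := K + 1) (x := (3/4 : ℝ)) (by norm_num) (by norm_num)
    rw [Finset.range_eq_Ico]
    refine this.trans ?_
    norm_num
  rw [Fin.sum_univ_eq_sum_range (fun i => cWt i) (K + 1)]
  unfold cWt
  rw [← Finset.sum_div]
  linarith

variable {K m : ℕ}

/-- The randomness of one walk: a grid value in `{0, …, N}` for every block. [folklore] -/
abbrev Env (K m : ℕ) : Type := Coord K m → Fin (gridN K + 1)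

/-- The grid value `η(c)/N ∈ [0, 1]` as a real number. [folklore] -/
def val (η : Env K m) (c : Coord K m) : ℝ := ((η c : ℕ) : ℝ) / gridN K

/-- `0 ≤ η(c)/N`. [folklore] -/
theorem val_nonneg (η : Env K m) (c : Coord K m) : 0 ≤ val η c := by
  unfold val; positivity

/-- `η(c)/N ≤ 1`. [folklore] -/
theorem val_le_one (η : Env K m) (c : Coord K m) : val η c ≤ 1 := by
  unfold val gridN
  rw [div_le_one (by positivity)]
  exact_mod_cast Nat.lt_succ_iff.1 (η c).2

/-! ### Velocity, position, lattice position -/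

/-- The velocity `v(t) = ∑_{i ≤ K} c_i · η(i, ⌊t/2^i⌋)/N ∈ [0, 1/2]`. [folklore] -/
def vel (η : Env K m) (t : ℕ) : ℝ := ∑ i : Fin (K + 1), cWt i * val η (i, blk m i t)

/-- `0 ≤ v(t)`. [folklore] -/
theorem vel_nonneg (η : Env K m) (t : ℕ) : 0 ≤ vel η t :=
  Finset.sum_nonneg fun i _ => mul_nonneg (cWt_pos i).le (val_nonneg η _)

/-- `v(t) ≤ 1/2`. [folklore] -/
theorem vel_le_half (η : Env K m) (t : ℕ) : vel η t ≤ 1 / 2 := by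
  refine le_trans (Finset.sum_le_sum fun i _ => ?_) (sum_cWt_le K)
  exact mul_le_of_le_one_right (cWt_pos i).le (val_le_one η _)

/-- The (real) position `W(t) = ∑_{t' < t} v(t')`. [folklore] -/
def pos (η : Env K m) (t : ℕ) : ℝ := ∑ t' ∈ Finset.range t, vel η t'

/-- The lattice position `S(t) = ⌊W(t)⌋`. [folklore] -/
def ipos (η : Env K m) (t : ℕ) : ℤ := ⌊pos η t⌋

/-- `W(0) = 0`. [folklore] -/
@[simp] theorem pos_zero (η : Env K m) : pos η 0 = 0 := by simp [pos]

/-- `W(t+1) = W(t) + v(t)`. [folklore] -/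
theorem pos_succ (η : Env K m) (t : ℕ) : pos η (t + 1) = pos η t + vel η t := by
  simp [pos, Finset.sum_range_succ]

/-- `0 ≤ W(t)`. [folklore] -/
theorem pos_nonneg (η : Env K m) (t : ℕ) : 0 ≤ pos η t :=
  Finset.sum_nonneg fun t' _ => vel_nonneg η t'

/-- `W(t) ≤ t/2`. [folklore] -/
theorem pos_le (η : Env K m) (t : ℕ) : pos η t ≤ t / 2 := by
  unfold pos
  calc ∑ t' ∈ Finset.range t, vel η t' ≤ ∑ _t' ∈ Finset.range t, (1 / 2 : ℝ) :=
        Finset.sum_le_sum fun t' _ => vel_le_half η t'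
    _ = t / 2 := by simp; ring

/-- `W` is monotone. [folklore] -/
theorem pos_mono (η : Env K m) : Monotone (pos η) :=
  monotone_nat_of_le_succ fun t => by rw [pos_succ]; exact le_add_of_nonneg_right (vel_nonneg η t)

/-- `S(0) = 0`. [folklore] -/
@[simp] theorem ipos_zero (η : Env K m) : ipos η 0 = 0 := by simp [ipos]

/-- `0 ≤ S(t)`. [folklore] -/
theorem ipos_nonneg (η : Env K m) (t : ℕ) : 0 ≤ ipos η t := Int.floor_nonneg.2 (pos_nonneg η t)

/-- `S(t) ≤ t/2` (as reals), i.e. the lazy walk moves at most at speed `1/2`. [folklore] -/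
theorem ipos_le (η : Env K m) (t : ℕ) : (ipos η t : ℝ) ≤ t / 2 :=
  (Int.floor_le _).trans (pos_le η t)

/-- **The steps of the lattice walk are `0` or `1`**: `S(t+1) − S(t) ∈ {0, 1}`. [folklore] -/
theorem ipos_succ_sub_mem (η : Env K m) (t : ℕ) :
    ipos η (t + 1) - ipos η t = 0 ∨ ipos η (t + 1) - ipos η t = 1 := by
  have h1 : ipos η t ≤ ipos η (t + 1) := Int.floor_mono (pos_mono η (Nat.le_succ t))
  have h2 : ipos η (t + 1) ≤ ipos η t + 1 := by
    unfold ipos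
    have : pos η (t + 1) < (⌊pos η t⌋ : ℝ) + 1 + 1 := by
      rw [pos_succ]
      have := Int.lt_floor_add_one (pos η t)
      have := vel_le_half η t
      linarith
    have := Int.floor_le_floor this.le
    rw [show (⌊pos η t⌋ : ℝ) + 1 + 1 = ((⌊pos η t⌋ + 1 + 1 : ℤ) : ℝ) by push_cast; ring,
      Int.floor_intCast] at this
    -- strict version
    have h3 : ⌊pos η (t + 1)⌋ < ⌊pos η t⌋ + 1 + 1 := by
      by_contra hc
      push Not at hc
      have := Int.floor_le (pos η (t + 1))
      have hc' : ((⌊pos η t⌋ + 1 + 1 : ℤ) : ℝ) ≤ ⌊pos η (t + 1)⌋ := by exact_mod_cast hc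
      push_cast at hc'
      linarith
    omega
  omega

/-- `S` is monotone. [folklore] -/
theorem ipos_mono (η : Env K m) : Monotone (ipos η) := fun _ _ h => Int.floor_mono (pos_mono η h)

/-- `|S(t+1) − S(t)| ≤ 1`. [folklore] -/
theorem abs_ipos_succ_sub_le (η : Env K m) (t : ℕ) : |ipos η (t + 1) - ipos η t| ≤ 1 := by
  rcases ipos_succ_sub_mem η t with h | h <;> simp [h]

/-! ### Locality: `W(t)` only sees blocks starting before `t` -/

/-- The block of scale `i` containing `t' < t` starts before `t`. [folklore] -/
theorem start_blk_lt (i : Fin (K + 1)) {t' t : ℕ} (h : t' < t) : start (i, blk m i t') < t := by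
  unfold start blk
  dsimp only
  calc min (t' / 2 ^ (i : ℕ)) m * 2 ^ (i : ℕ) ≤ t' / 2 ^ (i : ℕ) * 2 ^ (i : ℕ) :=
        Nat.mul_le_mul_right _ (min_le_left _ _)
    _ ≤ t' := Nat.div_mul_le_self t' _
    _ < t := h

/-- **Locality of the walk**: if two environments agree on all blocks starting before `t`, the
positions agree up to time `t`. [folklore] -/
theorem pos_congr {η η' : Env K m} {t : ℕ} (h : ∀ c : Coord K m, start c < t → η c = η' c) :
    pos η t = pos η' t := by
  unfold pos
  refine Finset.sum_congr rfl fun t' ht' => ?_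
  rw [Finset.mem_range] at ht'
  unfold vel
  refine Finset.sum_congr rfl fun i _ => ?_
  unfold val
  rw [h _ (start_blk_lt i ht')]

/-- Locality for the lattice position. [folklore] -/
theorem ipos_congr {η η' : Env K m} {t : ℕ} (h : ∀ c : Coord K m, start c < t → η c = η' c) :
    ipos η t = ipos η' t := by
  unfold ipos; rw [pos_congr h]

/-- In particular, changing a variable whose block starts at or after `t` does not change
`S(t)`. [folklore] -/
theorem ipos_update_of_le (η : Env K m) {c : Coord K m} {t : ℕ} (hc : t ≤ start c)
    (v : Fin (gridN K + 1)) : ipos (Function.update η c v) t = ipos η t :=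
  ipos_congr fun c' hc' => by
    rw [Function.update_of_ne]
    rintro rfl
    exact absurd hc' (not_lt.2 hc)

/-! ### Linearity in a single variable and the fibre count -/

/-- Changing the variable of block `c` shifts the velocity at time `t'` only if `t'` lies in that
block, and then linearly. [folklore] -/
theorem vel_update_sub (η : Env K m) (c : Coord K m) (v w : Fin (gridN K + 1)) (t' : ℕ) :
    vel (Function.update η c v) t' - vel (Function.update η c w) t' =
      cWt c.1 * ((((v : ℕ) : ℝ) - w) / gridN K) * (if blk m c.1 t' = c.2 then 1 else 0) := by
  unfold vel
  rw [← Finset.sum_sub_distrib]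
  rw [Finset.sum_eq_single c.1]
  · by_cases h : blk m c.1 t' = c.2
    · simp only [val, Function.update_self, h, if_true, mul_one, Prod.mk.eta]
      ring
    · have hc : (c.1, blk m c.1 t') ≠ c := fun e => h (congrArg Prod.snd e)
      simp [val, Function.update_of_ne hc, h]
  · intro i _ hi
    have hc : (i, blk m i t') ≠ c := fun e => hi (congrArg Prod.fst e)
    simp [val, Function.update_of_ne hc]
  · intro h; exact absurd (Finset.mem_univ _) h

/-- **Linearity of the position in one variable**: `W` depends on the variable of block `c`
affinely, with slope `c_{i} · #{t' < T in block c} / N`. [folklore] -/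
theorem pos_update_sub (η : Env K m) (c : Coord K m) (v w : Fin (gridN K + 1)) (T : ℕ) :
    pos (Function.update η c v) T - pos (Function.update η c w) T =
      cWt c.1 * ((((v : ℕ) : ℝ) - w) / gridN K) * #{t' ∈ Finset.range T | blk m c.1 t' = c.2} := by
  unfold pos
  rw [← Finset.sum_sub_distrib]
  simp_rw [vel_update_sub, ← Finset.mul_sum, Finset.sum_boole]

/-- **At most `ℓ/κ + 1` grid points in a window**: if the values `A + κ v` (`κ > 0`) of the
members `v` of a set of grid indices all lie in a half-open interval of length `ℓ ≥ 0`, the set has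
at most `ℓ/κ + 1` elements. [folklore] -/
theorem card_le_of_window {n : ℕ} {κ A z ℓ : ℝ} (hκ : 0 < κ) (hℓ : 0 ≤ ℓ) (F : Finset (Fin (n + 1)))
    (hF : ∀ v ∈ F, A + κ * ((v : ℕ) : ℝ) ∈ Set.Ico z (z + ℓ)) : (#F : ℝ) ≤ ℓ / κ + 1 := by
  rcases F.eq_empty_or_nonempty with rfl | hne
  · simp; positivity
  · set a := F.min' hne
    set b := F.max' hne
    have ha := hF a (F.min'_mem hne)
    have hb := hF b (F.max'_mem hne)
    have hab : κ * (((b : ℕ) : ℝ) - (a : ℕ)) < ℓ := by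
      have h1 := ha.1; have h2 := hb.2
      nlinarith
    have hab' : (((b : ℕ) : ℝ) - (a : ℕ)) < ℓ / κ := by
      rw [lt_div_iff₀ hκ]; linarith
    have hsub : F.image (fun v : Fin (n + 1) => (v : ℕ)) ⊆ Finset.Icc (a : ℕ) (b : ℕ) := by
      intro x hx
      rw [Finset.mem_image] at hx
      obtain ⟨v, hv, rfl⟩ := hx
      rw [Finset.mem_Icc]
      exact ⟨F.min'_le v hv, F.le_max' v hv⟩
    have hcard : #F ≤ (b : ℕ) + 1 - (a : ℕ) := by
      rw [← Finset.card_image_of_injective F Fin.val_injective, ← Nat.card_Icc]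
      exact Finset.card_le_card hsub
    have hle : (a : ℕ) ≤ (b : ℕ) := F.min'_le b (F.max'_mem hne)
    have : (#F : ℝ) ≤ ((b : ℕ) : ℝ) - (a : ℕ) + 1 := by
      have h := (Nat.cast_le (α := ℝ)).2 hcard
      rw [Nat.cast_sub (by omega), Nat.cast_add, Nat.cast_one] at h
      linarith
    linarith

/-- **The fibre count (predictability estimate)**: whatever the other variables are, at most
`9 / (c_i · #{t' < T in block c} / N) + 1` values of the variable of block `c = (i, b)` put the
lattice position `S(T)` within distance `4` of a given integer `Z`. [cite: BenjaminiPemantlePeres1998, §3 (predictability profile)] -/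
theorem card_fiber_le (η : Env K m) (c : Coord K m) (T : ℕ) (Z : ℤ)
    (hcnt : 0 < #{t' ∈ Finset.range T | blk m c.1 t' = c.2}) :
    (#{v : Fin (gridN K + 1) | |ipos (Function.update η c v) T - Z| ≤ 4} : ℝ) ≤
      9 / (cWt c.1 * #{t' ∈ Finset.range T | blk m c.1 t' = c.2} / gridN K) + 1 := by
  set cnt : ℕ := #{t' ∈ Finset.range T | blk m c.1 t' = c.2} with hcnt_def
  have hN : (0 : ℝ) < gridN K := by unfold gridN; positivity
  set κ : ℝ := cWt c.1 * cnt / gridN K with hκ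
  have hκ0 : 0 < κ := by rw [hκ]; exact div_pos (mul_pos (cWt_pos _) (by exact_mod_cast hcnt)) hN
  set A : ℝ := pos (Function.update η c 0) T with hA
  have hlin : ∀ v : Fin (gridN K + 1), pos (Function.update η c v) T = A + κ * ((v : ℕ) : ℝ) := by
    intro v
    have h := pos_update_sub η c v 0 T
    rw [← hcnt_def] at h
    simp only [Fin.val_zero, Nat.cast_zero, sub_zero] at h
    rw [hA, hκ]
    have : pos (Function.update η c v) T = pos (Function.update η c 0) T +
        cWt c.1 * (((v : ℕ) : ℝ) / gridN K) * cnt := by linarith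
    rw [this]; ring
  refine card_le_of_window (A := A) (z := (Z : ℝ) - 4) (ℓ := 9) hκ0 (by norm_num) _ fun v hv => ?_
  rw [Finset.mem_filter] at hv
  have hw := hv.2
  rw [← hlin v]
  have h1 := Int.floor_le (pos (Function.update η c v) T)
  have h2 := Int.lt_floor_add_one (pos (Function.update η c v) T)
  unfold ipos at hw
  rw [abs_le] at hw
  obtain ⟨hw1, hw2⟩ := hw
  have hw1' : ((Z : ℝ) - 4) ≤ (⌊pos (Function.update η c v) T⌋ : ℝ) := by exact_mod_cast (by linarith : Z - 4 ≤ _)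
  have hw2' : (⌊pos (Function.update η c v) T⌋ : ℝ) ≤ (Z : ℝ) + 4 := by exact_mod_cast (by linarith : _ ≤ Z + 4)
  refine ⟨?_, ?_⟩
  · show (Z : ℝ) - 4 ≤ _; linarith
  · show _ < (Z : ℝ) - 4 + 9; linarith

/-! ### The fresh block of a window -/

/-- The scale `i⋆ = ⌊log₂ r⌋ − 1` of the fresh block used for a window of length `r`. [folklore] -/
def freshScale (r : ℕ) : ℕ := Nat.log 2 r - 1

/-- The index `b⋆ = ⌊s / 2^{i⋆}⌋ + 1` of the fresh block of the window `[s, s + r)`. [folklore] -/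
def freshBlock (s r : ℕ) : ℕ := s / 2 ^ freshScale r + 1

/-- For `r ≥ 4`: `2 · 2^{i⋆} ≤ r`. [folklore] -/
theorem two_mul_pow_freshScale_le {r : ℕ} (hr : 4 ≤ r) : 2 * 2 ^ freshScale r ≤ r := by
  unfold freshScale
  have h2 : 2 ≤ Nat.log 2 r := Nat.le_log_of_pow_le (by norm_num) (by simpa using hr)
  have : 2 * 2 ^ (Nat.log 2 r - 1) = 2 ^ Nat.log 2 r := by
    rw [← pow_succ']; congr 1; omega
  rw [this]
  exact Nat.pow_log_le_self 2 (by omega)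

/-- The fresh block starts at or after `s`. [folklore] -/
theorem le_freshBlock_mul (s r : ℕ) : s ≤ freshBlock s r * 2 ^ freshScale r := by
  unfold freshBlock
  rw [Nat.add_mul, one_mul]
  exact (Nat.lt_div_mul_add (Nat.two_pow_pos _)).le

/-- The fresh block ends at or before `s + r` (`r ≥ 4`). [folklore] -/
theorem freshBlock_succ_mul_le {s r : ℕ} (hr : 4 ≤ r) :
    (freshBlock s r + 1) * 2 ^ freshScale r ≤ s + r := by
  unfold freshBlock
  have h := two_mul_pow_freshScale_le hr
  calc (s / 2 ^ freshScale r + 1 + 1) * 2 ^ freshScale r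
      = s / 2 ^ freshScale r * 2 ^ freshScale r + 2 * 2 ^ freshScale r := by ring
    _ ≤ s + r := Nat.add_le_add (Nat.div_mul_le_self _ _) h

/-- The fresh block fits below the horizon: `b⋆ < m` when `s + r ≤ m`. [folklore] -/
theorem freshBlock_lt {s r : ℕ} (hr : 4 ≤ r) (hm : s + r ≤ m) : freshBlock s r < m := by
  have h := freshBlock_succ_mul_le (s := s) hr
  have hp : 1 ≤ 2 ^ freshScale r := Nat.one_le_two_pow
  nlinarith

/-- The fresh scale is available: `i⋆ ≤ K` when `r ≤ m ≤ 2^K`. [folklore] -/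
theorem freshScale_le {r : ℕ} (hr : 4 ≤ r) (hrm : r ≤ m) (hK : m ≤ 2 ^ K) : freshScale r ≤ K := by
  have h := two_mul_pow_freshScale_le hr
  have : 2 ^ freshScale r < 2 ^ (K + 1) := by
    rw [pow_succ]
    omega
  have := (Nat.pow_lt_pow_iff_right (by norm_num : 1 < 2)).1 this
  omega

/-- The fresh coordinate `c⋆ = (i⋆, b⋆)` of the window `[s, s+r)` (as an element of `Coord K m`,
with truncations that are inactive under the hypotheses of the lemmas below). [folklore] -/
def freshCoord (K m s r : ℕ) : Coord K m :=
  (⟨min (freshScale r) K, Nat.lt_succ_of_le (min_le_right _ _)⟩,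
   ⟨min (freshBlock s r) m, Nat.lt_succ_of_le (min_le_right _ _)⟩)

/-- The components of the fresh coordinate under the standing hypotheses. [folklore] -/
theorem freshCoord_val {s r : ℕ} (hr : 4 ≤ r) (hm : s + r ≤ m) (hK : m ≤ 2 ^ K) :
    ((freshCoord K m s r).1 : ℕ) = freshScale r ∧ ((freshCoord K m s r).2 : ℕ) = freshBlock s r := by
  unfold freshCoord
  exact ⟨min_eq_left (freshScale_le hr (by omega) hK), min_eq_left (freshBlock_lt hr hm).le⟩

/-- **The fresh block starts at or after `s`**: `s ≤ start c⋆`. [folklore] -/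
theorem le_start_freshCoord {s r : ℕ} (hr : 4 ≤ r) (hm : s + r ≤ m) (hK : m ≤ 2 ^ K) :
    s ≤ start (freshCoord K m s r) := by
  obtain ⟨h1, h2⟩ := freshCoord_val (K := K) hr hm hK
  unfold start
  rw [h1, h2]
  exact le_freshBlock_mul s r

/-- **The fresh block lies entirely inside `[0, s + r)`**: the times `t' < s + r` in the block
`c⋆` are exactly `[b⋆ 2^{i⋆}, (b⋆+1) 2^{i⋆})`, `2^{i⋆}` of them. [folklore] -/
theorem card_filter_blk_freshCoord {s r : ℕ} (hr : 4 ≤ r) (hm : s + r ≤ m) (hK : m ≤ 2 ^ K) :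
    #{t' ∈ Finset.range (s + r) | blk m (freshCoord K m s r).1 t' = (freshCoord K m s r).2} =
      2 ^ freshScale r := by
  obtain ⟨h1, h2⟩ := freshCoord_val (K := K) hr hm hK
  have hend := freshBlock_succ_mul_le (s := s) hr
  set i := freshScale r
  set b := freshBlock s r
  have hp : 0 < 2 ^ i := Nat.two_pow_pos _
  have key : ∀ t', t' / 2 ^ i = b ↔ b * 2 ^ i ≤ t' ∧ t' < (b + 1) * 2 ^ i := fun t' => by
    rw [← Nat.le_div_iff_mul_le hp, ← Nat.div_lt_iff_lt_mul hp]; omega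
  have e : ({t' ∈ Finset.range (s + r) | blk m (freshCoord K m s r).1 t' = (freshCoord K m s r).2}) =
      Finset.Ico (b * 2 ^ i) ((b + 1) * 2 ^ i) := by
    ext t'
    simp only [Finset.mem_filter, Finset.mem_range, Finset.mem_Ico, blk, Fin.ext_iff, h1]
    rw [h2]
    constructor
    · rintro ⟨ht, hb⟩
      have hmin : min (t' / 2 ^ i) m = t' / 2 ^ i :=
        min_eq_left ((Nat.div_le_self _ _).trans (by omega))
      rw [hmin, key] at hb
      exact hb
    · rintro ⟨hlo, hhi⟩
      have ht : t' < s + r := lt_of_lt_of_le hhi hend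
      refine ⟨ht, ?_⟩
      have hmin : min (t' / 2 ^ i) m = t' / 2 ^ i :=
        min_eq_left ((Nat.div_le_self _ _).trans (by omega))
      rw [hmin, key]
      exact ⟨hlo, hhi⟩
  rw [e, Nat.card_Ico]
  have : (b + 1) * 2 ^ i = b * 2 ^ i + 2 ^ i := by ring
  rw [this, Nat.add_sub_cancel_left]

/-- **The unpredictability coefficient**: the slope of `W(s+r)` in the fresh variable is
`κ/N` with `κ = c_{i⋆} 2^{i⋆} = (3/2)^{i⋆}/8`. [folklore] -/
def kappa (r : ℕ) : ℝ := cWt (freshScale r) * 2 ^ freshScale r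

/-- `κ = (3/2)^{i⋆} / 8`. [folklore] -/
theorem kappa_eq (r : ℕ) : kappa r = (3 / 2 : ℝ) ^ freshScale r / 8 := by
  unfold kappa cWt
  rw [div_mul_eq_mul_div, ← mul_pow]
  norm_num

/-- `κ > 0`. [folklore] -/
theorem kappa_pos (r : ℕ) : 0 < kappa r := by rw [kappa_eq]; positivity

/-- `κ ≤ 2^{i⋆} ≤ N` when the scale is available. [folklore] -/
theorem kappa_le_gridN {r : ℕ} (hr : 4 ≤ r) (hrm : r ≤ m) (hK : m ≤ 2 ^ K) :
    kappa r ≤ gridN K := by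
  have hi := freshScale_le hr hrm hK
  unfold kappa cWt gridN
  have h1 : (3 / 4 : ℝ) ^ freshScale r / 8 * 2 ^ freshScale r ≤ 2 ^ freshScale r := by
    have : (3 / 4 : ℝ) ^ freshScale r / 8 ≤ 1 := by
      rw [div_le_one (by norm_num)]
      exact (pow_le_one₀ (by norm_num) (by norm_num)).trans (by norm_num)
    exact mul_le_of_le_one_left (by positivity) this
  refine h1.trans ?_
  exact_mod_cast Nat.pow_le_pow_right (by norm_num) hi

/-- **The fibre count at the fresh coordinate**: for `r ≥ 4`, `s + r ≤ m ≤ 2^K`, whatever the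
other variables are, at most `9N/κ + 1` of the `N + 1` values of the fresh variable put `S(s+r)`
within distance `4` of a given integer. [cite: BenjaminiPemantlePeres1998, §3 (predictability profile)] -/
theorem card_fiber_freshCoord_le {s r : ℕ} (hr : 4 ≤ r) (hm : s + r ≤ m) (hK : m ≤ 2 ^ K)
    (η : Env K m) (Z : ℤ) :
    (#{v : Fin (gridN K + 1) |
        |ipos (Function.update η (freshCoord K m s r) v) (s + r) - Z| ≤ 4} : ℝ) ≤
      9 * gridN K / kappa r + 1 := by
  have hcard := card_filter_blk_freshCoord (K := K) hr hm hK
  have h1 := (freshCoord_val (K := K) hr hm hK).1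
  have hpos : 0 < #{t' ∈ Finset.range (s + r) | blk m (freshCoord K m s r).1 t' = (freshCoord K m s r).2} := by
    rw [hcard]; exact Nat.two_pow_pos _
  have h := card_fiber_le η (freshCoord K m s r) (s + r) Z hpos
  rw [hcard, h1] at h
  have hN : (0 : ℝ) < gridN K := by unfold gridN; positivity
  convert h using 2
  unfold kappa
  push_cast
  field_simp

end DyadicWalk

end Literature.Probability.LatticeModels
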